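import Summits.BirchSwinnertonDyer.BirchSwinnertonDyer.Theorems.PrintCFramBottomClassIndexLawFiveLeSelmerDevissageLocalCriterion
import Summits.BirchSwinnertonDyer.BirchSwinnertonDyer.Theorems.PrintCFramBottomClassIndexLawFiveLeSelmerCountCaseS
import Summits.BirchSwinnertonDyer.BirchSwinnertonDyer.Theorems.PrintCFramBottomClassIndexLawFiveLeLevelDictionaryLocalInputs
import Summits.BirchSwinnertonDyer.BirchSwinnertonDyer.Theorems.RamifiedSevenEllipticUnitsStrictControlAnyPrime
import Literature.NumberTheory.EllipticCurves.LocalPointsPlaceTransportProofs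
import Literature.NumberTheory.GaloisRepresentations.DecompositionGroupOfCompletion
import HarnessLib

/-!
# Route `PrintCFram`, crux C2 `BottomClassIndexLawFiveLe` (stmt-BirchSwinnertonDyer-20372), line
# `eisenstein-resource-bdp-line` (registry v19, stub B1 `stub_bsdp_of_classFactor`): **CASE S OF THE B1 SELMER CENSUS IN
# LOCAL CURRENCY** — on the CM-ramified class the two inputs `W(ℚ_p)[p] = 0`, `(W[p]/Φ)^{D_p} = 0` of the local Kummer
# criterion are discharged, so ALIGNED/TRANSVERSE is decided by `p`-division points of `ℚ_p`-points, and w2 g9's CASE S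
# theorems hold with CASE S read locally
# (cell `bsd-print-cfram`, width seat `bsd-line-cfram-p1-w6` g4; helper `--supports` 20372; 0 defs, 0 facts, 0 sorry)

HONEST FRAMING. Nothing about BSD is proved unconditionally here and no stub is closed. Sequel of
`…SelmerDevissageLocalCriterion` (notation there: `v ∣ p`, `j : W(ℚ_v) → W(K̄_v)`, `ι = pointsMap`; a `Φ`-ADAPTED `p`-th
root of `P ∈ W(ℚ_v)` is `R` with `p • R = j P` and `σ • R − R ∈ ι(Φ)` on `Γ_v`; (LA)(Φ) «every rational local point has
one», (LT)(Φ) «every rational local point having one is `p`-divisible in `W(ℚ_v)`») and of w2 g9's `…SelmerCountCaseS`.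

* §1 THE CLASS INPUTS. For `W/ℚ` globally minimal with CM, `p ≥ 5` CM-ramified, `v ∣ p`, `Φ ≤ W[p]` a stable LINE
  (`#Φ = p`): **`quot_eq_zero_of_forall_decomp_smul_eq_of_cmRamified`** — `(W[p]/Φ)^{D_p} = 0` (w6 g3's inertia
  homothety `LevelDictionaryAlpha.quot_eq_zero_of_forall_inertia_smul_eq_at_p` at the prime `𝔓₀` of the chosen
  embedding, whose inertia group lies in `D_p = decomp v`: tree `decompositionSubgroup_adicCompletionPrime_eq_range`);
  **`natCard_ker_nsmul_adicCompletion_eq_one_of_cmRamified`** — `W(ℚ_v)[p] = 0` (k7r's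
  `prime_nsmul_eq_zero_padic_of_hasCM_of_cmRamified` transported from `ℚ_[p]` to `ℚ_v`). Hence
  **`forall_exists_adaptedRoot_or_forall_imp_of_cmRamified`**: for EVERY stable `Φ`, (LA)(Φ) ∨ (LT)(Φ), and never both —
  and by `…LocalCriterion` §1 the member is ALIGNED along `Φ` in the first case, TRANSVERSE in the second
  (**`aligned_or_transverse_of_cmRamified`**, both hypotheses of w2 g9's `aligned_or_transverse_selmerGroup` discharged).
* §2 CASE S IN LOCAL CURRENCY. **CASE S_loc** := «for every stable line `Φ` of order `p` and every complex conjugation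
  `c`: `c = −1` on `Φ` ⟹ (LT)(Φ); `c = +1` on `Φ` ⟹ (LA)(Φ)» — a condition on `W(ℚ_p)`, its `p`-division points and the
  sign of `c` on the line, with NO Selmer group in it. **`caseS_of_caseS_local`**: CASE S_loc ⟹ w2 g9's CASE S (verbatim
  hypothesis `hS` of `natCard_selmerGroup_le_sq_of_caseS`). Whence the CASE S package with `hS` replaced by CASE S_loc:
  **`natCard_selmerGroup_le_sq_of_caseS_local`** (`‖B_{1,ψ⁻¹}‖ = p⁻¹` ∧ CASE S_loc ∧ hMW ⊢ `#Sel_p(W/ℚ) ≤ p²`),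
  **`sha_noPTorsion_of_caseS_local`**, **`bsdp_iff_shaAnUnit_of_caseS_local`** (+ hCT, hGZK, `r_an = 1`:
  `Ш(W)[p] = 0` and `BSDp W p ↔ p ∤ #Ш_an(W)`).

So on B1's branch `v_p(B_{1,ψ⁻¹}) = 1` the case split of the census is now read on the member's `ℚ_p`-points: CASE S ⟺
«the model whose line `W[𝔭]` is ODD has `φ̂W'(ℚ_p) ⊆ pW(ℚ_p)`» (equivalently its partner, whose line is even, has
`W'(ℚ_p) = φW(ℚ_p) + pW'(ℚ_p)`); the Kodaira reading of that inclusion (Gealy–Klagsbrun 2017 Thm. 1, Schaefer's local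
index: «⟺ v_p(Δ_min) < 6 on the odd model») is NOT claimed. THEOREMS ONLY; no definition, no named fact, no `sorry`.
BSD is not proved by any of this; no summit statement is proved by this seat. References: [SilvermanAEC2009] X.§4
(diagram (**), Rem. 4.7); [MilneADT2006] I Lemma 3.3; [NeukirchANT1999] II (9.6); [GrossLMS1991] §9; seat notes w2g9 §3.
-/

set_option autoImplicit false
-- `…BirchSwinnertonDyer.BirchSwinnertonDyer.Theorems…` is the problem's mandated namespace (D-0017).
set_option linter.dupNamespace false

noncomputable section

open scoped Classical

namespace Summit.BirchSwinnertonDyer.BirchSwinnertonDyer.Theorems.PrintCFram.SelmerCount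

open NumberField IsDedekindDomain Field WeierstrassCurve DirichletCharacter
open Literature.NumberTheory.NumberFields Literature.NumberTheory.EllipticCurves Literature.NumberTheory.GaloisRepresentations
  Literature.NumberTheory.EllipticCurves.GreenbergSelmer Literature.NumberTheory.EllipticCurves.Rank1Residual
  Literature.NumberTheory.EllipticCurves.KrizLi2019
open Summit.BirchSwinnertonDyer.Rank1Residual Summit.BirchSwinnertonDyer.Rank1Residual.X2.ResidualDevissageModules
open Summit.BirchSwinnertonDyer.BirchSwinnertonDyer.Theorems.PrintCFram.LevelDictionaryAlpha

variable {p : ℕ} [hp : Fact p.Prime]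
variable (W : WeierstrassCurve ℚ) [W.IsElliptic] [W.IsGloballyMinimal]

/-! ## §1 The class inputs of the local criterion -/

section ClassInputs

omit [W.IsGloballyMinimal] in
/-- **`(W[p]/Φ)^{D_p} = 0` on the CM-ramified class.** For `W/ℚ` with CM, `p ≥ 5` CM-ramified, `Φ ≤ W[p]` a stable line of
order `p` and `v ∣ p`: a `D_p`-fixed element of `W[p]/Φ` is fixed by the inertia group of the prime `𝔓₀` above `v` cut out
by the chosen embedding (`I_{𝔓₀} ≤ D_{𝔓₀} = decomp v`, tree `decompositionSubgroup_adicCompletionPrime_eq_range`), hence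
zero by the inertia homothety (w6 g3 `quot_eq_zero_of_forall_inertia_smul_eq_at_p`). The hypothesis `hQD` of
`aligned_or_transverse_selmerGroup` / `transverse_of_forall_exists_adaptedRoot_imp`.
[cite: NeukirchANT1999, Ch. II §9 Prop. (9.6)] [cite: GrossLMS1991, §9] -/
theorem quot_eq_zero_of_forall_decomp_smul_eq_of_cmRamified (hCM : W.HasCM) (h5 : 5 ≤ p) (hram : CMRamified W p)
    (Φ : StableSubgroup (absoluteGaloisGroup ℚ) (geomTorsion W (p : ℤ))) (hcard : Nat.card Φ.Sub = p)
    {v : HeightOneSpectrum (𝓞 ℚ)} (hpv : ((p : ℕ) : 𝓞 ℚ) ∈ v.asIdeal)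
    (q : Φ.Quot) (hq : ∀ g ∈ decomp v, g • q = q) : q = 0 :=
  quot_eq_zero_of_forall_inertia_smul_eq_at_p W Φ hCM h5 hram hcard hpv (adicCompletionPrime_mem_primesAbove ℚ v) q
    fun g hg ↦ hq g (by
      have h := Ideal.inertia_le_decompositionSubgroup (absoluteGaloisGroup ℚ) (adicCompletionPrime ℚ v) hg
      rw [decompositionSubgroup_adicCompletionPrime_eq_range] at h
      exact h)

/-- **`W(ℚ_v)[p] = 0` on the CM-ramified class** (`W` globally minimal, CM, `p ≥ 5` CM-ramified, `v ∣ p`): k7r's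
`prime_nsmul_eq_zero_padic_of_hasCM_of_cmRamified` at `ℚ_[p]`, moved to the completion `ℚ_v`
(`natCard_ker_nsmul_adicCompletion_eq_one_of_forall_padic`). The hypothesis `htors` of the local dichotomy.
[cite: SilvermanAEC2009, VII.3.1 and VII.6.3] -/
theorem natCard_ker_nsmul_adicCompletion_eq_one_of_cmRamified (hCM : W.HasCM) (h5 : 5 ≤ p) (hram : CMRamified W p)
    {v : HeightOneSpectrum (𝓞 ℚ)} (hpv : ((p : ℕ) : 𝓞 ℚ) ∈ v.asIdeal) :
    Nat.card (nsmulAddMonoidHom p : (W.baseChange (v.adicCompletion ℚ)).toAffine.Point →+ _).ker = 1 :=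
  W.natCard_ker_nsmul_adicCompletion_eq_one_of_forall_padic hpv
    (RamifiedSevenEllipticUnits.prime_nsmul_eq_zero_padic_of_hasCM_of_cmRamified W p hCM h5 hram)

/-- **THE LOCAL DICHOTOMY ON THE CLASS.** For a CM-ramified class member (`p ≥ 5`, `v ∣ p`) and ANY stable `Φ ≤ W[p]`: (LA)(Φ)
or (LT)(Φ), and not both (`…LocalCriterion` §2 with `W(ℚ_v)[p] = 0` discharged). [cite: MilneADT2006, I Lemma 3.3] -/
theorem forall_exists_adaptedRoot_or_forall_imp_of_cmRamified (hCM : W.HasCM) (h5 : 5 ≤ p) (hram : CMRamified W p)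
    (Φ : StableSubgroup (absoluteGaloisGroup ℚ) (geomTorsion W (p : ℤ)))
    {v : HeightOneSpectrum (𝓞 ℚ)} (hpv : ((p : ℕ) : 𝓞 ℚ) ∈ v.asIdeal) :
    ((∀ P : (W.baseChange (v.adicCompletion ℚ)).toAffine.Point,
      ∃ R : localPoints W (v.adicCompletion ℚ),
        (p : ℤ) • R = Affine.Point.map (W' := W)
          (IsScalarTower.toAlgHom ℚ (v.adicCompletion ℚ) (AlgebraicClosure (v.adicCompletion ℚ))) P ∧
        ∀ σ : absoluteGaloisGroup (v.adicCompletion ℚ), ∃ t ∈ Φ.toAddSubgroup,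
          σ • R - R = pointsMap W (v.adicCompletion ℚ) (t : geomPoints W)) ∨
    (∀ P : (W.baseChange (v.adicCompletion ℚ)).toAffine.Point,
      (∃ R : localPoints W (v.adicCompletion ℚ),
        (p : ℤ) • R = Affine.Point.map (W' := W)
          (IsScalarTower.toAlgHom ℚ (v.adicCompletion ℚ) (AlgebraicClosure (v.adicCompletion ℚ))) P ∧
        ∀ σ : absoluteGaloisGroup (v.adicCompletion ℚ), ∃ t ∈ Φ.toAddSubgroup,
          σ • R - R = pointsMap W (v.adicCompletion ℚ) (t : geomPoints W)) →
      ∃ S : (W.baseChange (v.adicCompletion ℚ)).toAffine.Point, p • S = P)) ∧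
    ¬ ((∀ P : (W.baseChange (v.adicCompletion ℚ)).toAffine.Point,
      ∃ R : localPoints W (v.adicCompletion ℚ),
        (p : ℤ) • R = Affine.Point.map (W' := W)
          (IsScalarTower.toAlgHom ℚ (v.adicCompletion ℚ) (AlgebraicClosure (v.adicCompletion ℚ))) P ∧
        ∀ σ : absoluteGaloisGroup (v.adicCompletion ℚ), ∃ t ∈ Φ.toAddSubgroup,
          σ • R - R = pointsMap W (v.adicCompletion ℚ) (t : geomPoints W)) ∧
    (∀ P : (W.baseChange (v.adicCompletion ℚ)).toAffine.Point,
      (∃ R : localPoints W (v.adicCompletion ℚ),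
        (p : ℤ) • R = Affine.Point.map (W' := W)
          (IsScalarTower.toAlgHom ℚ (v.adicCompletion ℚ) (AlgebraicClosure (v.adicCompletion ℚ))) P ∧
        ∀ σ : absoluteGaloisGroup (v.adicCompletion ℚ), ∃ t ∈ Φ.toAddSubgroup,
          σ • R - R = pointsMap W (v.adicCompletion ℚ) (t : geomPoints W)) →
      ∃ S : (W.baseChange (v.adicCompletion ℚ)).toAffine.Point, p • S = P)) :=
  ⟨forall_exists_adaptedRoot_or_forall_imp W v Φ hpv (natCard_ker_nsmul_adicCompletion_eq_one_of_cmRamified W hCM h5 hram hpv),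
    fun h ↦ not_forall_exists_adaptedRoot_and W v Φ hpv h.1 h.2⟩

/-- **ALIGNED OR TRANSVERSE on the class, along every stable LINE, with both local inputs discharged** (w2 g9's
`aligned_or_transverse_selmerGroup` needed `W(ℚ_v)[p] = 0` and `(W[p]/Φ)^{D_p} = 0` as hypotheses).
[cite: MilneADT2006, I Lemma 3.3] [cite: GrossLMS1991, §9] -/
theorem aligned_or_transverse_of_cmRamified (hCM : W.HasCM) (h5 : 5 ≤ p) (hram : CMRamified W p)
    (Φ : StableSubgroup (absoluteGaloisGroup ℚ) (geomTorsion W (p : ℤ))) (hcard : Nat.card Φ.Sub = p)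
    {v : HeightOneSpectrum (𝓞 ℚ)} (hpv : ((p : ℕ) : 𝓞 ℚ) ∈ v.asIdeal) :
    (∀ z : contOneCocycles (discreteTopRep (absoluteGaloisGroup ℚ) (geomTorsion W (p : ℤ))),
        oneCocycleClass _ z ∈ selmerGroup W (p : ℤ) →
          ∃ q : Φ.Quot, ∀ g ∈ decomp v, Φ.proj (z.1 g) = g • q - q) ∨
      ∀ w : contOneCocycles (discreteTopRep (absoluteGaloisGroup ℚ) Φ.Sub),
        oneCocycleClass (discreteTopRep (absoluteGaloisGroup ℚ) (geomTorsion W (p : ℤ)))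
          (contOneCocycles.pullback (ContinuousMonoidHom.id _)
            (resHomOfEquivariant (ContinuousMonoidHom.id _) Φ.incl Φ.incl_smul) w) ∈ selmerGroup W (p : ℤ) →
          ∃ s : Φ.Sub, ∀ g ∈ decomp v, w.1 g = g • s - s :=
  aligned_or_transverse_selmerGroup_local W v Φ hpv
    (natCard_ker_nsmul_adicCompletion_eq_one_of_cmRamified W hCM h5 hram hpv)
    (quot_eq_zero_of_forall_decomp_smul_eq_of_cmRamified W hCM h5 hram Φ hcard hpv)

end ClassInputs

/-! ## §2 CASE S in local currency -/

section CaseSLocal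

omit [W.IsGloballyMinimal] in
/-- **CASE S_loc ⟹ CASE S.** On a CM-ramified class member (`p ≥ 5`, `v ∣ p`): if for every stable line `Φ` of order `p`
and every complex conjugation `c` one has «`c = −1` on `Φ` ⟹ (LT)(Φ)» and «`c = +1` on `Φ` ⟹ (LA)(Φ)» (CASE S_loc — a
condition on `W(ℚ_v)`, its `p`-division points and the sign of `c` on the line), then w2 g9's CASE S holds (hypothesis `hS` of
`natCard_selmerGroup_le_sq_of_caseS`, verbatim): by `transverse_of_forall_exists_adaptedRoot_imp` (with §1's `hQD`) and
`aligned_of_forall_exists_adaptedRoot`. [cite: SilvermanAEC2009, X.§4 (diagram (**), Rem. 4.7)] [cite: GrossLMS1991, §9] -/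
theorem caseS_of_caseS_local (hCM : W.HasCM) (h5 : 5 ≤ p) (hram : CMRamified W p)
    {v : HeightOneSpectrum (𝓞 ℚ)} (hpv : ((p : ℕ) : 𝓞 ℚ) ∈ v.asIdeal)
    (hSloc : ∀ (Φ : StableSubgroup (absoluteGaloisGroup ℚ) (geomTorsion W (p : ℤ))), Nat.card Φ.Sub = p →
      ∀ c : absoluteGaloisGroup ℚ, IsComplexConjugation (Rat.castHom ℝ) c →
        ((∀ x : Φ.Sub, c • x = -x) →
          ∀ P : (W.baseChange (v.adicCompletion ℚ)).toAffine.Point,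
            (∃ R : localPoints W (v.adicCompletion ℚ),
              (p : ℤ) • R = Affine.Point.map (W' := W)
                (IsScalarTower.toAlgHom ℚ (v.adicCompletion ℚ) (AlgebraicClosure (v.adicCompletion ℚ))) P ∧
              ∀ σ : absoluteGaloisGroup (v.adicCompletion ℚ), ∃ t ∈ Φ.toAddSubgroup,
                σ • R - R = pointsMap W (v.adicCompletion ℚ) (t : geomPoints W)) →
            ∃ S : (W.baseChange (v.adicCompletion ℚ)).toAffine.Point, p • S = P) ∧
        ((∀ x : Φ.Sub, c • x = x) →
          ∀ P : (W.baseChange (v.adicCompletion ℚ)).toAffine.Point,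
            ∃ R : localPoints W (v.adicCompletion ℚ),
              (p : ℤ) • R = Affine.Point.map (W' := W)
                (IsScalarTower.toAlgHom ℚ (v.adicCompletion ℚ) (AlgebraicClosure (v.adicCompletion ℚ))) P ∧
              ∀ σ : absoluteGaloisGroup (v.adicCompletion ℚ), ∃ t ∈ Φ.toAddSubgroup,
                σ • R - R = pointsMap W (v.adicCompletion ℚ) (t : geomPoints W))) :
    ∀ (Φ : StableSubgroup (absoluteGaloisGroup ℚ) (geomTorsion W (p : ℤ))), Nat.card Φ.Sub = p →
      ∀ c : absoluteGaloisGroup ℚ, IsComplexConjugation (Rat.castHom ℝ) c →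
        ((∀ x : Φ.Sub, c • x = -x) →
          ∀ w : contOneCocycles (discreteTopRep (absoluteGaloisGroup ℚ) Φ.Sub),
            oneCocycleClass (discreteTopRep (absoluteGaloisGroup ℚ) (geomTorsion W (p : ℤ)))
              (contOneCocycles.pullback (ContinuousMonoidHom.id _)
                (resHomOfEquivariant (ContinuousMonoidHom.id _) Φ.incl Φ.incl_smul) w) ∈ selmerGroup W (p : ℤ) →
              ∃ s : Φ.Sub, ∀ g ∈ decomp v, w.1 g = g • s - s) ∧
        ((∀ x : Φ.Sub, c • x = x) →
          ∀ z : contOneCocycles (discreteTopRep (absoluteGaloisGroup ℚ) (geomTorsion W (p : ℤ))),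
            oneCocycleClass _ z ∈ selmerGroup W (p : ℤ) →
              ∃ q : Φ.Quot, ∀ g ∈ decomp v, Φ.proj (z.1 g) = g • q - q) := by
  intro Φ hcard c hc
  refine ⟨fun hodd w hw ↦ ?_, fun heven z hz ↦ ?_⟩
  · exact transverse_of_forall_exists_adaptedRoot_imp W v Φ
      (quot_eq_zero_of_forall_decomp_smul_eq_of_cmRamified W hCM h5 hram Φ hcard hpv) ((hSloc Φ hcard c hc).1 hodd) w hw
  · exact aligned_of_forall_exists_adaptedRoot W v Φ ((hSloc Φ hcard c hc).2 heven) z hz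

/-- **`‖B_{1,ψ⁻¹}‖ = p⁻¹` ∧ CASE S_loc ⟹ `#Sel_p(W/ℚ) ≤ p²`** — w2 g9's `natCard_selmerGroup_le_sq_of_caseS` with its CASE S
hypothesis replaced by CASE S_loc (read on `W(ℚ_v)` and its `p`-division points); conditional on Mazur–Wiles Thm 2 (`hMW`) as
there. [cite: MazurWiles1984, Thm. 2 (p. 214)] [cite: SilvermanAEC2009, X.§4 (diagram (**), Rem. 4.7)] -/
theorem natCard_selmerGroup_le_sq_of_caseS_local (hMW : MazurWiles1984.thm2_card_oddChiClassGroup_eq_bernoulli)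
    (hCM : W.HasCM) (hram : CMRamified W p) (h5 : 5 ≤ p)
    {f : ℕ} [NeZero f] (ψ : DirichletCharacter ℚ_[p] f) (ω : DirichletCharacter ℚ_[p] p)
    (hψ : ψ.Odd) (hω : IsTeichmullerCharacter ω)
    (hss : ∀ ℓ : ℕ, ℓ.Prime → ¬ (ℓ ∣ p * W.conductorNorm ℤ) →
      ‖((W.LFunction ℓ : ℤ) : ℚ_[p]) - (ψ (ℓ : ZMod f) + ψ⁻¹ (ℓ : ZMod f) * ω (ℓ : ZMod p))‖ < 1)
    (hB : ‖bernoulliOnePrim ψ⁻¹‖ = (p : ℝ)⁻¹)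
    {v : HeightOneSpectrum (𝓞 ℚ)} (hpv : ((p : ℕ) : 𝓞 ℚ) ∈ v.asIdeal)
    (hSloc : ∀ (Φ : StableSubgroup (absoluteGaloisGroup ℚ) (geomTorsion W (p : ℤ))), Nat.card Φ.Sub = p →
      ∀ c : absoluteGaloisGroup ℚ, IsComplexConjugation (Rat.castHom ℝ) c →
        ((∀ x : Φ.Sub, c • x = -x) →
          ∀ P : (W.baseChange (v.adicCompletion ℚ)).toAffine.Point,
            (∃ R : localPoints W (v.adicCompletion ℚ),
              (p : ℤ) • R = Affine.Point.map (W' := W)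
                (IsScalarTower.toAlgHom ℚ (v.adicCompletion ℚ) (AlgebraicClosure (v.adicCompletion ℚ))) P ∧
              ∀ σ : absoluteGaloisGroup (v.adicCompletion ℚ), ∃ t ∈ Φ.toAddSubgroup,
                σ • R - R = pointsMap W (v.adicCompletion ℚ) (t : geomPoints W)) →
            ∃ S : (W.baseChange (v.adicCompletion ℚ)).toAffine.Point, p • S = P) ∧
        ((∀ x : Φ.Sub, c • x = x) →
          ∀ P : (W.baseChange (v.adicCompletion ℚ)).toAffine.Point,
            ∃ R : localPoints W (v.adicCompletion ℚ),
              (p : ℤ) • R = Affine.Point.map (W' := W)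
                (IsScalarTower.toAlgHom ℚ (v.adicCompletion ℚ) (AlgebraicClosure (v.adicCompletion ℚ))) P ∧
              ∀ σ : absoluteGaloisGroup (v.adicCompletion ℚ), ∃ t ∈ Φ.toAddSubgroup,
                σ • R - R = pointsMap W (v.adicCompletion ℚ) (t : geomPoints W))) :
    Nat.card (selmerGroup W (p : ℤ)) ≤ p ^ 2 :=
  natCard_selmerGroup_le_sq_of_caseS W hMW hCM hram h5 ψ ω hψ hω hss hB hpv
    (caseS_of_caseS_local W hCM h5 hram hpv hSloc)

/-- **`‖B_{1,ψ⁻¹}‖ = p⁻¹` ∧ CASE S_loc ⟹ `Ш(W)[p] = 0`** (+ hMW, hCT, hGZK, `r_an = 1`) — w2 g9's `sha_noPTorsion_of_caseS`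
with CASE S read locally. [cite: MazurWiles1984, Thm. 2 (p. 214)] [cite: Cassels1962ArithmeticIV] -/
theorem sha_noPTorsion_of_caseS_local (hMW : MazurWiles1984.thm2_card_oddChiClassGroup_eq_bernoulli)
    (hCT : exists_casselsTate_pairing (K := ℚ)) (hGZK : rank_eq_analyticRank_of_analyticRank_le_one)
    (hCM : W.HasCM) (hram : CMRamified W p) (h5 : 5 ≤ p) (hr : W.analyticRank = 1)
    {f : ℕ} [NeZero f] (ψ : DirichletCharacter ℚ_[p] f) (ω : DirichletCharacter ℚ_[p] p)
    (hψ : ψ.Odd) (hω : IsTeichmullerCharacter ω)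
    (hss : ∀ ℓ : ℕ, ℓ.Prime → ¬ (ℓ ∣ p * W.conductorNorm ℤ) →
      ‖((W.LFunction ℓ : ℤ) : ℚ_[p]) - (ψ (ℓ : ZMod f) + ψ⁻¹ (ℓ : ZMod f) * ω (ℓ : ZMod p))‖ < 1)
    (hB : ‖bernoulliOnePrim ψ⁻¹‖ = (p : ℝ)⁻¹)
    {v : HeightOneSpectrum (𝓞 ℚ)} (hpv : ((p : ℕ) : 𝓞 ℚ) ∈ v.asIdeal)
    (hSloc : ∀ (Φ : StableSubgroup (absoluteGaloisGroup ℚ) (geomTorsion W (p : ℤ))), Nat.card Φ.Sub = p →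
      ∀ c : absoluteGaloisGroup ℚ, IsComplexConjugation (Rat.castHom ℝ) c →
        ((∀ x : Φ.Sub, c • x = -x) →
          ∀ P : (W.baseChange (v.adicCompletion ℚ)).toAffine.Point,
            (∃ R : localPoints W (v.adicCompletion ℚ),
              (p : ℤ) • R = Affine.Point.map (W' := W)
                (IsScalarTower.toAlgHom ℚ (v.adicCompletion ℚ) (AlgebraicClosure (v.adicCompletion ℚ))) P ∧
              ∀ σ : absoluteGaloisGroup (v.adicCompletion ℚ), ∃ t ∈ Φ.toAddSubgroup,
                σ • R - R = pointsMap W (v.adicCompletion ℚ) (t : geomPoints W)) →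
            ∃ S : (W.baseChange (v.adicCompletion ℚ)).toAffine.Point, p • S = P) ∧
        ((∀ x : Φ.Sub, c • x = x) →
          ∀ P : (W.baseChange (v.adicCompletion ℚ)).toAffine.Point,
            ∃ R : localPoints W (v.adicCompletion ℚ),
              (p : ℤ) • R = Affine.Point.map (W' := W)
                (IsScalarTower.toAlgHom ℚ (v.adicCompletion ℚ) (AlgebraicClosure (v.adicCompletion ℚ))) P ∧
              ∀ σ : absoluteGaloisGroup (v.adicCompletion ℚ), ∃ t ∈ Φ.toAddSubgroup,
                σ • R - R = pointsMap W (v.adicCompletion ℚ) (t : geomPoints W))) :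
    ∀ x : W.sha, (p : ℤ) • x = 0 → x = 0 :=
  sha_noPTorsion_of_caseS W hMW hCT hGZK hCM hram h5 hr ψ ω hψ hω hss hB hpv
    (caseS_of_caseS_local W hCM h5 hram hpv hSloc)

/-- **`‖B_{1,ψ⁻¹}‖ = p⁻¹` ∧ CASE S_loc ⟹ (`BSDp W p ↔ p ∤ #Ш_an(W)`)** (+ hMW, hCT, hGZK, `r_an = 1`) — w2 g9's
`bsdp_iff_shaAnUnit_of_caseS` with CASE S read locally: on this branch of B1 the `p`-part of BSD is Heegner `p`-primitivity.
[cite: MazurWiles1984, Thm. 2 (p. 214)] [cite: Cassels1962ArithmeticIV] [cite: Miller2011LMS, Def. 1.1] -/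
theorem bsdp_iff_shaAnUnit_of_caseS_local (hMW : MazurWiles1984.thm2_card_oddChiClassGroup_eq_bernoulli)
    (hCT : exists_casselsTate_pairing (K := ℚ)) (hGZK : rank_eq_analyticRank_of_analyticRank_le_one)
    (hCM : W.HasCM) (hram : CMRamified W p) (h5 : 5 ≤ p) (hr : W.analyticRank = 1)
    {f : ℕ} [NeZero f] (ψ : DirichletCharacter ℚ_[p] f) (ω : DirichletCharacter ℚ_[p] p)
    (hψ : ψ.Odd) (hω : IsTeichmullerCharacter ω)
    (hss : ∀ ℓ : ℕ, ℓ.Prime → ¬ (ℓ ∣ p * W.conductorNorm ℤ) →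
      ‖((W.LFunction ℓ : ℤ) : ℚ_[p]) - (ψ (ℓ : ZMod f) + ψ⁻¹ (ℓ : ZMod f) * ω (ℓ : ZMod p))‖ < 1)
    (hB : ‖bernoulliOnePrim ψ⁻¹‖ = (p : ℝ)⁻¹)
    {v : HeightOneSpectrum (𝓞 ℚ)} (hpv : ((p : ℕ) : 𝓞 ℚ) ∈ v.asIdeal)
    (hSloc : ∀ (Φ : StableSubgroup (absoluteGaloisGroup ℚ) (geomTorsion W (p : ℤ))), Nat.card Φ.Sub = p →
      ∀ c : absoluteGaloisGroup ℚ, IsComplexConjugation (Rat.castHom ℝ) c →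
        ((∀ x : Φ.Sub, c • x = -x) →
          ∀ P : (W.baseChange (v.adicCompletion ℚ)).toAffine.Point,
            (∃ R : localPoints W (v.adicCompletion ℚ),
              (p : ℤ) • R = Affine.Point.map (W' := W)
                (IsScalarTower.toAlgHom ℚ (v.adicCompletion ℚ) (AlgebraicClosure (v.adicCompletion ℚ))) P ∧
              ∀ σ : absoluteGaloisGroup (v.adicCompletion ℚ), ∃ t ∈ Φ.toAddSubgroup,
                σ • R - R = pointsMap W (v.adicCompletion ℚ) (t : geomPoints W)) →
            ∃ S : (W.baseChange (v.adicCompletion ℚ)).toAffine.Point, p • S = P) ∧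
        ((∀ x : Φ.Sub, c • x = x) →
          ∀ P : (W.baseChange (v.adicCompletion ℚ)).toAffine.Point,
            ∃ R : localPoints W (v.adicCompletion ℚ),
              (p : ℤ) • R = Affine.Point.map (W' := W)
                (IsScalarTower.toAlgHom ℚ (v.adicCompletion ℚ) (AlgebraicClosure (v.adicCompletion ℚ))) P ∧
              ∀ σ : absoluteGaloisGroup (v.adicCompletion ℚ), ∃ t ∈ Φ.toAddSubgroup,
                σ • R - R = pointsMap W (v.adicCompletion ℚ) (t : geomPoints W))) :
    BSDp W p ↔ ∃ q : ℚ, shaAn W = (q : ℂ) ∧ padicValRat p q = 0 :=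
  bsdp_iff_shaAnUnit_of_caseS W hMW hCT hGZK hCM hram h5 hr ψ ω hψ hω hss hB hpv
    (caseS_of_caseS_local W hCM h5 hram hpv hSloc)

end CaseSLocal

end Summit.BirchSwinnertonDyer.BirchSwinnertonDyer.Theorems.PrintCFram.SelmerCount

end
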